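import Summits.CriticalPhenomena.PercolationContinuityZ3.Theorems.PercNearOneGluingNoHeavyLowerTailAntiBandDominance
import Summits.CriticalPhenomena.PercolationContinuityZ3.Theorems.PercNearOneGluingNoHeavyLowerTailAntiBandCylinderShifted
import Summits.CriticalPhenomena.PercolationContinuityZ3.Theorems.PercNearOneGluingNoHeavyLowerTailAntiBandDegenerate

/-!
# `NoHeavyLowerTail` (crux stmt-CriticalPhenomena-4575), lane prim-ineq-gen-4 (gen 34): THE ANTI-BAND INEQUALITY ON THE WHOLE DIAGONAL —
# (AB_m)(2m) for every `m` and every pair of upper sets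

Support file (`--supports stmt-CriticalPhenomena-4575`; memo `run/shared/lean/prim/prim-ineq-gen-4/FINDING-CYLINDER-g34.md` §7).
No definitions, no `sorry`, standard axioms.

**THEOREM (`antiBand_diagonal`).**  For every `m ≥ 1` and all upper sets `W, V ⊆ 2^{Fin (2m)}`:
`#{s ∈ W ∩ Vᶜˢ | #s < m ∨ #sᶜ < m} ≤ #{s ∈ W ∩ V | #s < m ∨ #sᶜ < m}`,
i.e. the anti-band inequality (AB_l)(y) on the diagonal `y = 2l` — the cells `(12,5) = (AB_6)(12)`, `(14,6)`, `(16,7)`, … that the certificate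
methods of gens 22–28 left open ("first open cell (12,5)").  With gen 22's frames (`(AB_6)(y)`, `y ≥ 13`) this completes (AB_6) for all `y`.

PROOF.  (1) Gen 20's opposite-compression lemma reduces to `W` left-shifted, `V` right-shifted (`AntiBandShiftReduction`, `AntiBandCylinderShifted.
antiBand_of_forall_rightShifted`).  (2) MIDDLE LEVEL (`card_midLevel_inter_le`): on `L = {#s = m}` disagreements dominate agreements,
`#(W ∩ V ∩ L) ≤ #(W ∩ Vᶜˢ ∩ L)`.  Indeed `L` is a sublattice of the dominance (prefix-count) lattice (gen 34, `AntiBandDominance`: it is the Young lattice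
`L(m,m)`), `A = W ∩ L` and `D = {x ∈ L | xᶜ ∈ V}` are upper sets of it, `B = V ∩ L` and `C = {x ∈ L | xᶜ ∈ W}` are lower sets (a right-shifted family is
closed under moving elements to the right, which inside a level is going DOWN in the prefix-count order), so by Daykin's inequality
`N·(#(A∩B) + #(C∩D) − #(A∩D) − #(B∩C)) ≤ (#A − #C)(#B − #D) = 0` because complementation is a bijection of the middle level (`#A = #C`).
(3) Kleitman's lemma twice on the whole cube (`AntiBandDegenerate.card_inter_le_card_compls_inter`): `#(W ∩ Vᶜˢ) ≤ #(W ∩ V)`.  Subtracting (2) from (3)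
gives the inequality on the outer levels `#s ≠ m`.
-/

namespace Summit.CriticalPhenomena.PercolationContinuityZ3.Theorems.AntiBandDiagonal

open Finset AntiBandDominance
open scoped FinsetFamily

variable {n : ℕ}

/-- **Right-shifted families are closed under moving right inside a level.**  If `V` is compressed along `({j},{i})` for all `i < j`, `x ∈ V`, `#y = #x`, and
every prefix count of `y` is at most that of `x`, then `y ∈ V` (exchange argument). [folklore; mirror of `AntiBandDominance.mem_of_prefix_le`] -/
theorem mem_of_prefix_ge_of_card_eq (V : Finset (Finset (Fin n)))
    (hsh : ∀ i j : Fin n, i < j → UV.IsCompressed ({j} : Finset (Fin n)) {i} V) :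
    ∀ (d : ℕ) (x y : Finset (Fin n)), #(x \ y) = d → x ∈ V → #y = #x →
      (∀ k : ℕ, #(y.filter fun a : Fin n => (a : ℕ) < k) ≤ #(x.filter fun a : Fin n => (a : ℕ) < k)) → y ∈ V := by
  classical
  intro d
  induction d with
  | zero =>
    intro x y hd hx hcard _
    rw [card_eq_zero, sdiff_eq_empty_iff_subset] at hd
    rwa [← eq_of_subset_of_card_le hd hcard.le]
  | succ d ih =>
    intro x y hd hx hcard hle
    have hne : (x \ y).Nonempty := by rw [← card_pos, hd]; exact Nat.succ_pos d
    have hne' : (y \ x).Nonempty := by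
      rw [← card_pos]
      have h1 := card_sdiff_add_card_inter x y; have h2 := card_sdiff_add_card_inter y x
      rw [inter_comm] at h2; omega
    set j : Fin n := (x \ y).min' hne with hjdef
    set i : Fin n := (y \ x).min' hne' with hidef
    have hj : j ∈ x ∧ j ∉ y := by rw [← mem_sdiff]; exact min'_mem _ hne
    have hi : i ∈ y ∧ i ∉ x := by rw [← mem_sdiff]; exact min'_mem _ hne'
    -- every element of `y` below `i` lies in `x`; every element of `x` below `j` lies in `y`
    have hybelow : ∀ a ∈ y, a < i → a ∈ x := fun a hay hai => by
      by_contra hax; exact absurd (min'_le _ a (mem_sdiff.2 ⟨hay, hax⟩)) (not_le.2 hai)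
    have hxbelow : ∀ a ∈ x, a < j → a ∈ y := fun a hax haj => by
      by_contra hay; exact absurd (min'_le _ a (mem_sdiff.2 ⟨hax, hay⟩)) (not_le.2 haj)
    -- `j < i`
    have hji : j < i := by
      rcases lt_trichotomy j i with h | h | h
      · exact h
      · exact absurd (h ▸ hj.1) hi.2
      · exfalso
        have hsub : x.filter (fun a : Fin n => (a : ℕ) < (i : ℕ) + 1) ⊆ (y.filter fun a : Fin n => (a : ℕ) < (i : ℕ) + 1).erase i := by
          intro a ha
          rw [mem_filter] at ha
          have hai : a < j := by
            have : (a : ℕ) ≤ (i : ℕ) := by omega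
            exact lt_of_le_of_lt (Fin.le_def.2 this) h
          rw [mem_erase, mem_filter]
          exact ⟨fun hai' => hi.2 (hai' ▸ ha.1), hxbelow a ha.1 hai, ha.2⟩
        have h1 := card_le_card hsub
        rw [card_erase_of_mem (mem_filter.2 ⟨hi.1, Nat.lt_succ_self _⟩)] at h1
        have h2 := hle ((i : ℕ) + 1)
        have h3 : 0 < #(y.filter fun a : Fin n => (a : ℕ) < (i : ℕ) + 1) := card_pos.2 ⟨i, mem_filter.2 ⟨hi.1, Nat.lt_succ_self _⟩⟩
        omega
    -- move `j` to `i`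
    set x' : Finset (Fin n) := insert i (x.erase j) with hx'def
    have hx'V : x' ∈ V := AntiBandCylinder.insert_erase_mem_of_isCompressed (hsh j i hji) hx hj.1 hi.2
    have hcard' : #x' = #x := by
      rw [hx'def, card_insert_of_notMem (fun h => hi.2 (mem_of_mem_erase h)), card_erase_of_mem hj.1]
      have := card_pos.2 ⟨j, hj.1⟩; omega
    have hsd : #(x' \ y) = d := by
      have : x' \ y = (x \ y).erase j := by
        ext a
        rw [hx'def, mem_sdiff, mem_insert, mem_erase, mem_erase, mem_sdiff]
        constructor
        · rintro ⟨h1 | ⟨h1, h2⟩, h3⟩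
          · exact absurd hi.1 (h1 ▸ h3)
          · exact ⟨h1, h2, h3⟩
        · rintro ⟨h1, h2, h3⟩; exact ⟨Or.inr ⟨h1, h2⟩, h3⟩
      rw [this, card_erase_of_mem (mem_sdiff.2 hj), hd]; rfl
    refine ih x' y hsd hx'V (hcard.trans hcard'.symm) fun k => ?_
    by_cases hk : k ≤ (j : ℕ)
    · -- below `j` nothing changed
      have : x'.filter (fun a : Fin n => (a : ℕ) < k) = x.filter (fun a : Fin n => (a : ℕ) < k) := by
        ext a
        rw [mem_filter, mem_filter, hx'def, mem_insert, mem_erase]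
        constructor
        · rintro ⟨h1 | ⟨_, h2⟩, h3⟩
          · exfalso; rw [h1] at h3; have : (j : ℕ) < (i : ℕ) := hji; omega
          · exact ⟨h2, h3⟩
        · rintro ⟨h1, h2⟩; exact ⟨Or.inr ⟨fun h => by rw [h] at h2; omega, h1⟩, h2⟩
      rw [this]; exact hle k
    · push Not at hk
      by_cases hk' : k ≤ (i : ℕ)
      · -- `j < k ≤ i`: `y` below `k` lies in `x` minus `j`
        have hsub : y.filter (fun a : Fin n => (a : ℕ) < k) ⊆ (x.filter fun a : Fin n => (a : ℕ) < k).erase j := by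
          intro a ha
          rw [mem_filter] at ha
          rw [mem_erase, mem_filter]
          refine ⟨fun h => hj.2 (h ▸ ha.1), hybelow a ha.1 ?_, ha.2⟩
          exact Fin.lt_def.2 (by omega)
        have hsub' : (x.filter fun a : Fin n => (a : ℕ) < k).erase j ⊆ x'.filter (fun a : Fin n => (a : ℕ) < k) := by
          intro a ha
          rw [mem_erase, mem_filter] at ha
          rw [mem_filter, hx'def, mem_insert, mem_erase]
          exact ⟨Or.inr ⟨ha.1, ha.2.1⟩, ha.2.2⟩
        exact card_le_card (hsub.trans hsub')
      · push Not at hk'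
        have : x'.filter (fun a : Fin n => (a : ℕ) < k) = insert i ((x.filter fun a : Fin n => (a : ℕ) < k).erase j) := by
          ext a
          rw [mem_filter, hx'def, mem_insert, mem_erase, mem_insert, mem_erase, mem_filter]
          constructor
          · rintro ⟨h1 | ⟨h1, h2⟩, h3⟩
            · exact Or.inl h1
            · exact Or.inr ⟨h1, h2, h3⟩
          · rintro (h1 | ⟨h1, h2, h3⟩)
            · exact ⟨Or.inl h1, by rw [h1]; exact hk'⟩
            · exact ⟨Or.inr ⟨h1, h2⟩, h3⟩
        rw [this, card_insert_of_notMem (fun h => hi.2 (mem_filter.1 (mem_of_mem_erase h)).1),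
          card_erase_of_mem (mem_filter.2 ⟨hj.1, by omega⟩)]
        have h0 : 0 < #(x.filter fun a : Fin n => (a : ℕ) < k) := card_pos.2 ⟨j, mem_filter.2 ⟨hj.1, by omega⟩⟩
        have := hle k; omega

/-- **Positive correlation of prefix-upper families inside a LEVEL** (Daykin's inequality in `Fin (n+1) → ℕ`; the level `{#s = m}` is a sublattice of the
dominance lattice). [this work; cf. `AntiBandDominance.card_mul_le_of_prefixUp` for the outer shell] -/
theorem card_mul_le_of_prefixUp_level (m : ℕ) (U U' : Finset (Finset (Fin n)))
    (hU : U ⊆ univ.filter fun s : Finset (Fin n) => #s = m) (hU' : U' ⊆ univ.filter fun s : Finset (Fin n) => #s = m)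
    (hUp : ∀ x ∈ U, ∀ z : Finset (Fin n), #z = m → (∀ k : ℕ, #(x.filter fun a : Fin n => (a : ℕ) < k) ≤ #(z.filter fun a : Fin n => (a : ℕ) < k)) → z ∈ U)
    (hUp' : ∀ x ∈ U', ∀ z : Finset (Fin n), #z = m → (∀ k : ℕ, #(x.filter fun a : Fin n => (a : ℕ) < k) ≤ #(z.filter fun a : Fin n => (a : ℕ) < k)) → z ∈ U') :
    #U * #U' ≤ #(univ.filter fun s : Finset (Fin n) => #s = m) * #(U ∩ U') := by
  classical
  set L := univ.filter fun s : Finset (Fin n) => #s = m with hL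
  set E : Finset (Fin n) → (Fin (n + 1) → ℕ) := fun x k => #(x.filter fun a : Fin n => (a : ℕ) < (k : ℕ)) with hE
  have hEinj : Function.Injective E := by
    intro x y h
    ext a
    have h0 := congrFun h ⟨a, Nat.lt_succ_of_lt a.2⟩
    have h1 := congrFun h ⟨a + 1, Nat.succ_lt_succ a.2⟩
    simp only [hE] at h0 h1
    rw [card_filter_lt_succ x a a.2, card_filter_lt_succ y a a.2, h0] at h1
    have ha : (⟨(a : ℕ), a.2⟩ : Fin n) = a := Fin.ext rfl
    rw [ha] at h1
    by_cases hx : a ∈ x <;> by_cases hy : a ∈ y <;> simp only [hx, hy, if_true, if_false] at h1 <;> first | omega | tauto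
  have hmem : ∀ z : Finset (Fin n), z ∈ L ↔ #z = m := fun z => by rw [hL, mem_filter]; simp only [mem_univ, true_and]
  have hcard : ∀ z : Finset (Fin n), #(z.filter fun a : Fin n => (a : ℕ) < n) = #z := fun z => card_filter_lt_of_le z n le_rfl
  have hsups : (U.image E) ⊻ (U'.image E) ⊆ (U ∩ U').image E := by
    intro v hv
    rw [mem_sups] at hv
    obtain ⟨a, ha, b, hb, rfl⟩ := hv
    obtain ⟨x, hx, rfl⟩ := mem_image.1 ha
    obtain ⟨y, hy, rfl⟩ := mem_image.1 hb
    obtain ⟨z, hz⟩ := exists_prefix_eq_max x y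
    have hEz : E x ⊔ E y = E z := by funext k; simp only [hE, Pi.sup_apply]; rw [hz k]
    have hzc : #z = m := by
      have h := hz n; rw [hcard, hcard, hcard, (hmem x).1 (hU hx), (hmem y).1 (hU' hy), max_self] at h; exact h
    rw [hEz, mem_image]
    refine ⟨z, mem_inter.2 ⟨hUp x hx z hzc fun k => ?_, hUp' y hy z hzc fun k => ?_⟩, rfl⟩
    · rw [hz k]; exact le_max_left _ _
    · rw [hz k]; exact le_max_right _ _
  have hinfs : (U.image E) ⊼ (U'.image E) ⊆ L.image E := by
    intro v hv
    rw [mem_infs] at hv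
    obtain ⟨a, ha, b, hb, rfl⟩ := hv
    obtain ⟨x, hx, rfl⟩ := mem_image.1 ha
    obtain ⟨y, hy, rfl⟩ := mem_image.1 hb
    obtain ⟨z, hz⟩ := exists_prefix_eq_min x y
    have hEz : E x ⊓ E y = E z := by funext k; simp only [hE, Pi.inf_apply]; rw [hz k]
    have hzc : #z = m := by
      have h := hz n; rw [hcard, hcard, hcard, (hmem x).1 (hU hx), (hmem y).1 (hU' hy), min_self] at h; exact h
    rw [hEz, mem_image]
    exact ⟨z, (hmem z).2 hzc, rfl⟩
  have hD := (U.image E).le_card_infs_mul_card_sups (U'.image E)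
  rw [card_image_of_injective _ hEinj, card_image_of_injective _ hEinj] at hD
  calc #U * #U' ≤ #((U.image E) ⊼ (U'.image E)) * #((U.image E) ⊻ (U'.image E)) := hD
    _ ≤ #(L.image E) * #((U ∩ U').image E) := Nat.mul_le_mul (card_le_card hinfs) (card_le_card hsups)
    _ = #L * #(U ∩ U') := by rw [card_image_of_injective _ hEinj, card_image_of_injective _ hEinj]

/-- **Disagreements dominate on the middle level.**  Let `n = 2m`, `W` a left-shifted upper set (compressed along `({i},{j})`, `i < j`) and `V` a right-shifted
upper set (compressed along `({j},{i})`, `i < j`).  Then `#{s ∈ W ∩ V | #s = m} ≤ #{s ∈ W ∩ Vᶜˢ | #s = m}`.  (Daykin four times in the Young lattice `L(m,m)`,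
and `#(W ∩ L_m) = #{x ∈ L_m | xᶜ ∈ W}`.) [this work, memo §7] -/
theorem card_midLevel_inter_le (m : ℕ) (hn : n = 2 * m) (W V : Finset (Finset (Fin n)))
    (hW : IsUpperSet (W : Set (Finset (Fin n)))) (hWsh : ∀ i j : Fin n, i < j → UV.IsCompressed ({i} : Finset (Fin n)) {j} W)
    (hVsh : ∀ i j : Fin n, i < j → UV.IsCompressed ({j} : Finset (Fin n)) {i} V) :
    #((W ∩ V).filter fun s => #s = m) ≤ #((W ∩ Vᶜˢ).filter fun s => #s = m) := by
  classical
  set L := univ.filter fun s : Finset (Fin n) => #s = m with hL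
  have hmem : ∀ z : Finset (Fin n), z ∈ L ↔ #z = m := fun z => by rw [hL, mem_filter]; simp only [mem_univ, true_and]
  have hcc : ∀ s : Finset (Fin n), #sᶜ = n - #s := fun s => by rw [card_compl, Fintype.card_fin]
  have hcm : ∀ s : Finset (Fin n), #s = m → #sᶜ = m := fun s hs => by rw [hcc, hs]; omega
  -- prefix counts of complements
  have hcompl : ∀ (s : Finset (Fin n)) (k : ℕ), #(sᶜ.filter fun a : Fin n => (a : ℕ) < k) + #(s.filter fun a : Fin n => (a : ℕ) < k)
      = #((univ : Finset (Fin n)).filter fun a : Fin n => (a : ℕ) < k) := by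
    intro s k
    rw [← card_union_of_disjoint (disjoint_filter_filter (compl_eq_univ_sdiff s ▸ sdiff_disjoint : Disjoint sᶜ s)), ← filter_union,
      compl_eq_univ_sdiff, sdiff_union_of_subset (subset_univ s)]
  set A := W.filter fun s => #s = m with hA
  set B := V.filter fun s => #s = m with hB
  set C := L.filter fun s => sᶜ ∈ W with hC
  set D := L.filter fun s => sᶜ ∈ V with hD
  have hAL : A ⊆ L := fun s hs => by rw [hA, mem_filter] at hs; exact (hmem s).2 hs.2
  have hBL : B ⊆ L := fun s hs => by rw [hB, mem_filter] at hs; exact (hmem s).2 hs.2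
  have hCL : C ⊆ L := filter_subset _ _
  have hDL : D ⊆ L := filter_subset _ _
  have hmA : ∀ s, s ∈ A ↔ s ∈ W ∧ #s = m := fun s => by rw [hA, mem_filter]
  have hmB : ∀ s, s ∈ B ↔ s ∈ V ∧ #s = m := fun s => by rw [hB, mem_filter]
  have hmC : ∀ s, s ∈ C ↔ #s = m ∧ sᶜ ∈ W := fun s => by rw [hC, mem_filter, hmem]
  have hmD : ∀ s, s ∈ D ↔ #s = m ∧ sᶜ ∈ V := fun s => by rw [hD, mem_filter, hmem]
  -- the four prefix-upper families inside `L`: `A`, `D`, `L \\ B`, `L \\ C`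
  have hupA : ∀ x ∈ A, ∀ z : Finset (Fin n), #z = m →
      (∀ k : ℕ, #(x.filter fun a : Fin n => (a : ℕ) < k) ≤ #(z.filter fun a : Fin n => (a : ℕ) < k)) → z ∈ A := by
    intro x hx z hz hle; rw [hA, mem_filter] at hx ⊢
    exact ⟨mem_of_prefix_le W hW hWsh _ x z rfl hx.1 hle, hz⟩
  have hupD : ∀ x ∈ D, ∀ z : Finset (Fin n), #z = m →
      (∀ k : ℕ, #(x.filter fun a : Fin n => (a : ℕ) < k) ≤ #(z.filter fun a : Fin n => (a : ℕ) < k)) → z ∈ D := by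
    intro x hx z hz hle; rw [hD, mem_filter, hmem] at hx ⊢
    refine ⟨hz, mem_of_prefix_ge_of_card_eq V hVsh _ xᶜ zᶜ rfl hx.2 (by rw [hcm z hz, hcm x hx.1]) fun k => ?_⟩
    have h1 := hcompl x k; have h2 := hcompl z k; have h3 := hle k; omega
  have hupB : ∀ x ∈ L \ B, ∀ z : Finset (Fin n), #z = m →
      (∀ k : ℕ, #(x.filter fun a : Fin n => (a : ℕ) < k) ≤ #(z.filter fun a : Fin n => (a : ℕ) < k)) → z ∈ L \ B := by
    intro x hx z hz hle; rw [mem_sdiff, hmem, hB, mem_filter] at hx ⊢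
    refine ⟨hz, fun hzB => hx.2 ⟨mem_of_prefix_ge_of_card_eq V hVsh _ z x rfl hzB.1 (by rw [hx.1, hz]) hle, hx.1⟩⟩
  have hupC : ∀ x ∈ L \ C, ∀ z : Finset (Fin n), #z = m →
      (∀ k : ℕ, #(x.filter fun a : Fin n => (a : ℕ) < k) ≤ #(z.filter fun a : Fin n => (a : ℕ) < k)) → z ∈ L \ C := by
    intro x hx z hz hle; rw [mem_sdiff, hmem, hC, mem_filter, hmem] at hx ⊢
    refine ⟨hz, fun hzC => hx.2 ⟨hx.1, mem_of_prefix_le W hW hWsh _ zᶜ xᶜ rfl hzC.2 fun k => ?_⟩⟩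
    have h1 := hcompl x k; have h2 := hcompl z k; have h3 := hle k; omega
  -- Daykin four times
  have h1 := card_mul_le_of_prefixUp_level m A D hAL hDL hupA hupD
  have h2 := card_mul_le_of_prefixUp_level m (L \ B) (L \ C) sdiff_subset sdiff_subset hupB hupC
  have h3 := card_mul_le_of_prefixUp_level m A (L \ B) hAL sdiff_subset hupA hupB
  have h4 := card_mul_le_of_prefixUp_level m D (L \ C) hDL sdiff_subset hupD hupC
  rw [← hL] at h1 h2 h3 h4
  -- cardinality bookkeeping inside `L`
  have eLB : #(L \ B) = #L - #B := card_sdiff_of_subset hBL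
  have eLC : #(L \ C) = #L - #C := card_sdiff_of_subset hCL
  have eBC : #((L \ B) ∩ (L \ C)) + #B + #C = #L + #(B ∩ C) := by
    have e1 : (L \ B) ∩ (L \ C) = L \ (B ∪ C) := by
      ext s; rw [mem_inter, mem_sdiff, mem_sdiff, mem_sdiff, mem_union]; tauto
    rw [e1, card_sdiff_of_subset (union_subset hBL hCL)]
    have e2 := card_union_add_card_inter B C
    have e3 := card_le_card (union_subset hBL hCL); omega
  have eAB : #(A ∩ (L \ B)) + #(A ∩ B) = #A := by
    rw [← card_union_of_disjoint (disjoint_left.2 fun s h1 h2 => (mem_sdiff.1 (mem_inter.1 h1).2).2 (mem_inter.1 h2).2)]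
    congr 1; ext s; rw [mem_union, mem_inter, mem_inter, mem_sdiff]
    constructor
    · rintro (⟨h, -⟩ | ⟨h, -⟩) <;> exact h
    · intro h; by_cases hb : s ∈ B; exacts [Or.inr ⟨h, hb⟩, Or.inl ⟨h, hAL h, hb⟩]
  have eDC : #(D ∩ (L \ C)) + #(D ∩ C) = #D := by
    rw [← card_union_of_disjoint (disjoint_left.2 fun s h1 h2 => (mem_sdiff.1 (mem_inter.1 h1).2).2 (mem_inter.1 h2).2)]
    congr 1; ext s; rw [mem_union, mem_inter, mem_inter, mem_sdiff]
    constructor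
    · rintro (⟨h, -⟩ | ⟨h, -⟩) <;> exact h
    · intro h; by_cases hc : s ∈ C; exacts [Or.inr ⟨h, hc⟩, Or.inl ⟨h, hDL h, hc⟩]
  -- `#A = #C` (complementation is a bijection of the middle level)
  have eAC : #A = #C := by
    refine card_bij (fun s _ => sᶜ) (fun s hs => ?_) (fun s₁ _ s₂ _ h => compl_injective h) (fun s hs => ?_)
    · rw [hmA] at hs; rw [hmC, compl_compl]; exact ⟨hcm s hs.2, hs.1⟩
    · rw [hmC] at hs
      exact ⟨sᶜ, by rw [hmA]; exact ⟨hs.2, hcm s hs.1⟩, compl_compl s⟩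
  -- identify the two sides
  have eL : (W ∩ V).filter (fun s => #s = m) = A ∩ B := by
    ext s; rw [mem_filter, mem_inter, mem_inter, hmA, hmB]; tauto
  have eR : (W ∩ Vᶜˢ).filter (fun s => #s = m) = A ∩ D := by
    ext s; rw [mem_filter, mem_inter, mem_compls, mem_inter, hmA, hmD]; tauto
  have eCD : #(D ∩ C) = #(A ∩ B) := by
    refine card_bij (fun s _ => sᶜ) (fun s hs => ?_) (fun s₁ _ s₂ _ h => compl_injective h) (fun s hs => ?_)
    · rw [mem_inter, hmD, hmC] at hs
      rw [mem_inter, hmA, hmB]; exact ⟨⟨hs.2.2, hcm s hs.1.1⟩, hs.1.2, hcm s hs.1.1⟩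
    · rw [mem_inter, hmA, hmB] at hs
      refine ⟨sᶜ, ?_, compl_compl s⟩
      rw [mem_inter, hmD, hmC, compl_compl]
      exact ⟨⟨hcm s hs.1.2, hs.2.1⟩, hcm s hs.1.2, hs.1.1⟩
  have eBC' : #(B ∩ C) = #(A ∩ D) := by
    refine card_bij (fun s _ => sᶜ) (fun s hs => ?_) (fun s₁ _ s₂ _ h => compl_injective h) (fun s hs => ?_)
    · rw [mem_inter, hmB, hmC] at hs
      rw [mem_inter, hmA, hmD, compl_compl]; exact ⟨⟨hs.2.2, hcm s hs.1.2⟩, hcm s hs.1.2, hs.1.1⟩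
    · rw [mem_inter, hmA, hmD] at hs
      refine ⟨sᶜ, ?_, compl_compl s⟩
      rw [mem_inter, hmB, hmC, compl_compl]
      exact ⟨⟨hs.2.2, hcm s hs.1.2⟩, hcm s hs.1.2, hs.1.1⟩
  rw [eL, eR]
  rw [inter_comm D C] at eDC eCD
  have hBle : #B ≤ #L := card_le_card hBL
  have hCle : #C ≤ #L := card_le_card hCL
  -- the four clean correlations, in ℤ
  have I1 : (#A : ℤ) * #D ≤ #L * #(A ∩ D) := by exact_mod_cast h1
  have I2 : (#B : ℤ) * #C ≤ #L * #(B ∩ C) := by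
    have h := h2; rw [eLB, eLC] at h; zify [hBle, hCle] at h
    have e : (#((L \ B) ∩ (L \ C)) : ℤ) = #L + #(B ∩ C) - #B - #C := by have := eBC; zify at this; linarith
    rw [e] at h
    have h' : ((#L : ℤ) - #B) * (#L - #C) = #L * #L - #L * #C - #L * #B + #B * #C := by ring
    have h'' : (#L : ℤ) * (#L + #(B ∩ C) - #B - #C) = #L * #L + #L * #(B ∩ C) - #L * #B - #L * #C := by ring
    rw [h', h''] at h; linarith
  have I3 : (#L : ℤ) * #(A ∩ B) ≤ #A * #B := by
    have h := h3; rw [eLB] at h; zify [hBle] at h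
    have e : (#(A ∩ (L \ B)) : ℤ) = #A - #(A ∩ B) := by have := eAB; zify at this; linarith
    rw [e, mul_sub, mul_sub, mul_comm (#A : ℤ) #L] at h; linarith
  have I4 : (#L : ℤ) * #(C ∩ D) ≤ #D * #C := by
    have h := h4; rw [eLC] at h; zify [hCle] at h
    have e : (#(D ∩ (L \ C)) : ℤ) = #D - #(C ∩ D) := by have := eDC; zify at this; linarith
    rw [e, mul_sub, mul_sub, mul_comm (#D : ℤ) #L] at h; linarith
  have eAC' : (#A : ℤ) = #C := by exact_mod_cast eAC
  have eCD' : (#(C ∩ D) : ℤ) = #(A ∩ B) := by exact_mod_cast eCD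
  have eBC'' : (#(B ∩ C) : ℤ) = #(A ∩ D) := by exact_mod_cast eBC'
  rw [eAC'] at I1 I3
  rw [eCD'] at I4
  rw [eBC''] at I2
  by_cases hL0 : #L = 0
  · have : #(A ∩ B) = 0 := by have := card_le_card (inter_subset_left.trans hAL : A ∩ B ⊆ L); omega
    rw [this]; exact Nat.zero_le _
  · have hLpos : (0 : ℤ) < #L := by exact_mod_cast Nat.pos_of_ne_zero hL0
    have key : (#L : ℤ) * #(A ∩ B) ≤ #L * #(A ∩ D) := by
      have s1 := add_le_add I3 I4
      have s2 := add_le_add I1 I2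
      linarith [mul_comm (#C : ℤ) #B, mul_comm (#D : ℤ) #C, mul_comm (#B : ℤ) #C, mul_comm (#C : ℤ) #D]
    have := le_of_mul_le_mul_left key hLpos
    exact_mod_cast this

/-- **(AB_m)(2m) for shifted pairs.**  `n = 2m`, `W` a left-shifted upper set, `V` a right-shifted upper set:
`#{s ∈ W ∩ Vᶜˢ | #s < m ∨ #sᶜ < m} ≤ #{s ∈ W ∩ V | #s < m ∨ #sᶜ < m}` — Kleitman twice on the cube minus `card_midLevel_inter_le`. [this work] -/
theorem antiBand_diagonal_shifted (m : ℕ) (hn : n = 2 * m) (W V : Finset (Finset (Fin n)))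
    (hW : IsUpperSet (W : Set (Finset (Fin n)))) (hV : IsUpperSet (V : Set (Finset (Fin n))))
    (hWsh : ∀ i j : Fin n, i < j → UV.IsCompressed ({i} : Finset (Fin n)) {j} W)
    (hVsh : ∀ i j : Fin n, i < j → UV.IsCompressed ({j} : Finset (Fin n)) {i} V) :
    #((W ∩ Vᶜˢ).filter fun s => #s < m ∨ #sᶜ < m) ≤ #((W ∩ V).filter fun s => #s < m ∨ #sᶜ < m) := by
  classical
  -- outer ⇔ not on the middle level
  have hout : ∀ s : Finset (Fin n), (#s < m ∨ #sᶜ < m) ↔ ¬ #s = m := by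
    intro s; rw [card_compl, Fintype.card_fin]; have := card_le_univ s; rw [Fintype.card_fin] at this; omega
  have hsplit : ∀ X : Finset (Finset (Fin n)), #(X.filter fun s => #s < m ∨ #sᶜ < m) + #(X.filter fun s => #s = m) = #X := by
    intro X
    rw [filter_congr (fun s _ => hout s), add_comm]
    exact card_filter_add_card_filter_not (fun s => #s = m)
  -- Kleitman twice on the whole cube: `#(W ∩ Vᶜˢ) ≤ #(W ∩ V)`
  have hVc : IsLowerSet ((Vᶜˢ : Finset (Finset (Fin n))) : Set (Finset (Fin n))) := by
    intro a b hab ha; rw [mem_coe, mem_compls] at ha ⊢; exact hV (compl_subset_compl.2 hab) ha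
  have hfull : #(W ∩ Vᶜˢ) ≤ #(W ∩ V) := by
    have h := AntiBandDegenerate.card_inter_le_card_compls_inter Vᶜˢ W hVc hW
    rwa [compls_compls, inter_comm, inter_comm V] at h
  have hmid := card_midLevel_inter_le m hn W V hW hWsh hVsh
  have e1 := hsplit (W ∩ Vᶜˢ); have e2 := hsplit (W ∩ V)
  omega

/-- **THE DIAGONAL THEOREM: (AB_m)(2m) for ALL pairs of upper sets.**  For every `m` and all upper sets `W, V ⊆ 2^{Fin (2m)}`:
`#{s ∈ W ∩ Vᶜˢ | #s < m ∨ #sᶜ < m} ≤ #{s ∈ W ∩ V | #s < m ∨ #sᶜ < m}`.  Reduction to shifted pairs by gen 20's opposite-compression lemma: strong induction on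
the Kruskal–Katona measure of `W` (`AntiBandShiftReduction.measure_compression_lt`), then `AntiBandCylinderShifted.antiBand_of_forall_rightShifted` for `V`.
[this work, FINDING-CYLINDER-g34.md §7] -/
theorem antiBand_diagonal (m : ℕ) (hn : n = 2 * m) (W V : Finset (Finset (Fin n)))
    (hW : IsUpperSet (W : Set (Finset (Fin n)))) (hV : IsUpperSet (V : Set (Finset (Fin n)))) :
    #((W ∩ Vᶜˢ).filter fun s => #s < m ∨ #sᶜ < m) ≤ #((W ∩ V).filter fun s => #s < m ∨ #sᶜ < m) := by
  classical
  suffices hmain : ∀ (k : ℕ) (A B : Finset (Finset (Fin n))), (∑ s ∈ A, ∑ a ∈ s, 2 ^ (a : ℕ)) = k →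
      IsUpperSet (A : Set (Finset (Fin n))) → IsUpperSet (B : Set (Finset (Fin n))) →
      #((A ∩ Bᶜˢ).filter fun s => #s < m ∨ #sᶜ < m) ≤ #((A ∩ B).filter fun s => #s < m ∨ #sᶜ < m) from
    hmain _ W V rfl hW hV
  intro k
  induction k using Nat.strong_induction_on with
  | _ k ih =>
    intro A B hk hA hB
    by_cases hsh : ∀ i j : Fin n, i < j → UV.IsCompressed ({i} : Finset (Fin n)) {j} A
    · exact AntiBandCylinderShifted.antiBand_of_forall_rightShifted m A hsh
        (fun V' hV'up hV'sh => antiBand_diagonal_shifted m hn A V' hA hV'up hsh hV'sh) B hB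
    · push Not at hsh
      obtain ⟨i, j, hij, hnc⟩ := hsh
      have hne : 𝓒 ({i} : Finset (Fin n)) {j} A ≠ A := hnc
      set A' := 𝓒 ({i} : Finset (Fin n)) {j} A with hA'
      set B' := 𝓒 ({j} : Finset (Fin n)) {i} B with hB'
      have hijne : i ≠ j := ne_of_lt hij
      have hA'up : IsUpperSet (A' : Set (Finset (Fin n))) := AntiBandShiftReduction.isUpperSet_compression_singleton hijne hA
      have hB'up : IsUpperSet (B' : Set (Finset (Fin n))) := AntiBandShiftReduction.isUpperSet_compression_singleton hijne.symm hB
      have hlt : (∑ s ∈ A', ∑ a ∈ s, 2 ^ (a : ℕ)) < k := by rw [← hk]; exact AntiBandShiftReduction.measure_compression_lt hij hne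
      have hrec := ih _ hlt A' B' rfl hA'up hB'up
      have hdisj : Disjoint ({i} : Finset (Fin n)) {j} := disjoint_singleton.2 hijne
      have hL := AntiBandShift.antiBand_compression_swap_le hdisj (by rw [card_singleton, card_singleton]) m A B
      have h1 : (0 : ℤ) ≤ (#((A' ∩ B').filter fun s => #s < m ∨ #sᶜ < m) : ℤ) - #((A' ∩ B'ᶜˢ).filter fun s => #s < m ∨ #sᶜ < m) := by
        have := hrec; omega
      have h2 := h1.trans hL
      omega

end Summit.CriticalPhenomena.PercolationContinuityZ3.Theorems.AntiBandDiagonal
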